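import Literature.NumberTheory.Sieve.HeathBrownCubicSiegelWalfisz
import HarnessLib

/-!
# Heath-Brown's Lemma 8.1, step (8.1): the norm form, the Möbius rearrangement, the classes `[J, q]`

Layer of the decomposition of **parity.S18**
(`Literature.NumberTheory.Sieve.setOf_prime_cube_add_two_mul_cube_infinite`) along D. R. Heath-Brown,
*Primes represented by `x³ + 2y³`*, Acta Math. 186 (2001), 1–84, inside the proof of **Lemma 8.1**
(p. 47), the `e`-half of Lemma 3.8 (`HeathBrownCubicSiegelWalfisz`). The proof begins (pp. 47–48):

> "According to the definition (3.12) we have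
> `∑_{β ≡ α (mod q), β̂ ∈ 𝒞} e_(β) = M⁻¹(ξ log X)^{−n−1} ∑_{N(J) < L} μ(J) log(L/N(J)) ∑_{β̂ ∈ 𝒞, J ∣ β, β ≡ α (mod q)} w'(N(β))`. (8.1)
> The two conditions `J ∣ β` and `β ≡ α (mod q)` are compatible only when `(J, q) ∣ α`, and in this
> latter case they define a unique residue class for `β` modulo the lowest common multiple `[J, q]`."

This file PROVES:

* `norm_coordElt`, `absNorm_span_coordElt`, `absNorm_span_coordElt_real` — the norm form in three
  variables, `N(x + y·2^{1/3} + z·4^{1/3}) = x³ + 2y³ + 4z³ − 6xyz` (the determinant of multiplication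
  by `x + yθ + zθ²` on `1, θ, θ²`, extending `norm_add_mul_θint` of `HeathBrownCubicSieveSetup`), whence
  `N((β)) = |N(β̂)|` for the `normForm` of `HeathBrownCubicSiegelWalfisz` (the `w'(N(β))` of (8.1) is
  `w'` at the ideal norm of `(β)`, the `𝓘` of Lemma 8.1 integrates `w'(N(𝐱))` with the norm FORM);
* **`cubeClassSum_eWeight_eq`** — (8.1), an identity valid for every `X > 0`, with the prefactor in
  the form `(∏ m_iξ log X)⁻¹` of (3.12) (`= M⁻¹(ξ log X)^{−n−1}`) and `smallIdeals L` the finite set of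
  `J` with `N(J) < L` (it contains `J = 0`, harmless as `μ(0) = 0`; the term `β = 0`, if present,
  vanishes on both sides as `w'(0) = 0`);
* `exists_mem_and_dvd_sub_iff` — "compatible only when `(J, q) ∣ α`": a `β₀ ∈ J` with
  `β₀ ≡ α (mod q)` exists iff `α ∈ J + (q)`; `dvd_span_and_dvd_sub_iff` — "a unique residue class
  modulo `[J, q]`": then `J ∣ β ∧ β ≡ α (mod q)` iff `β − β₀ ∈ J ∩ (q)`; `absNorm_inf_span_le`
  (`N(J ∩ (q)) ≤ N(J)q³`, the paper's `r = N([J, q]) ≤ N(J)q³`), `inf_span_ne_bot`.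

The continuation — the classes modulo `r = N([J, q])` and (8.5) summed over them, (8.7) and the
Möbius sums — is in the sibling files `HeathBrownCubicETermClasses`, `HeathBrownCubicIdealMoebius`,
`HeathBrownCubicETermMainTerm`.

## References

* D. R. Heath-Brown, *Primes represented by `x³ + 2y³`*, Acta Math. 186 (2001), 1–84: §8, proof of
  Lemma 8.1, (8.1) and the sentence after it (pp. 47–48). [cite: HeathBrownActa2001, §8 (8.1)]

## Mathlib / tree search

Mathlib: `Algebra.norm_eq_matrix_det`, `Matrix.det_fin_three`, `Algebra.coe_norm_int`,
`Ideal.absNorm_span_singleton`, `Ideal.dvd_span_singleton`, `Ideal.mem_span_singleton`,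
`Submodule.mem_sup`, `Ideal.mul_le_inf`, `Ideal.absNorm_dvd_absNorm_of_le`, `Finset.sum_comm`,
`Finset.sum_filter`; no norm form of `ℤ[2^{1/3}]` in three variables (the tree has two:
`norm_add_mul_θint`). Tree: `HeathBrownCubicSieveSetup` (`pbX`, `pbX_dim`, `leftMulMatrix_mk`,
`cubicPolyRat_monic/degree/eq`, `idealsLE`), `HeathBrownCubicTypeII` (`eWeight`, `idealDivisors`,
`mem_idealDivisors_iff`, `idealMoebius`, `wDeriv_eq_zero`, `coordElt`, `latticeCube`, `hbL`, `hbXi`),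
`HeathBrownCubicSiegelWalfisz` (`cubeClassSum`, `normForm`, `absNorm_span_natCast_K`), `CubeRootTwoField`
(`θ`, `θint`, `coe_θint`).
-/

noncomputable section

open Polynomial NumberField Finset

namespace Literature.NumberTheory.Sieve.CubicSieve

open LFunctions.CubeRootTwoField CubicPrimes

/-! ### The norm form `N(x + y·2^{1/3} + z·4^{1/3}) = x³ + 2y³ + 4z³ − 6xyz` -/

/-- Reduction modulo `X³ − 2` to an explicit quadratic remainder, with any quotient. [folklore] -/
theorem modByMonic_cubicPolyRat_eq' {q : ℚ[X]} (a b c : ℚ) (k : ℚ[X])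
    (h : q - (C a * X ^ 2 + C b * X + C c) = cubicPolyRat * k) :
    q %ₘ cubicPolyRat = C a * X ^ 2 + C b * X + C c := by
  rw [modByMonic_eq_of_dvd_sub cubicPolyRat_monic (Dvd.intro _ h.symm),
    modByMonic_eq_self_iff cubicPolyRat_monic, cubicPolyRat_degree]
  exact degree_quadratic_le.trans_lt (by decide)

/-- **The norm form on `𝓞_K = ℤ[2^{1/3}]` in three variables**:
`N(x + y·2^{1/3} + z·4^{1/3}) = x³ + 2y³ + 4z³ − 6xyz`, computed as the determinant
`|x 2z 2y; y x 2z; z y x|` of multiplication by `x + yθ + zθ²` on `1, θ, θ²`. [folklore] -/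
theorem norm_coordElt (v : ℤ × ℤ × ℤ) :
    Algebra.norm ℤ (coordElt v) = v.1 ^ 3 + 2 * v.2.1 ^ 3 + 4 * v.2.2 ^ 3 - 6 * v.1 * v.2.1 * v.2.2 := by
  classical
  obtain ⟨x, y, z⟩ := v
  simp only
  set p : ℚ[X] := C (z : ℚ) * X ^ 2 + C (y : ℚ) * X + C (x : ℚ) with hp
  -- the three columns `p X^j mod (X³ − 2)`, `j = 0, 1, 2`
  have r0 : p %ₘ cubicPolyRat = C (z : ℚ) * X ^ 2 + C (y : ℚ) * X + C (x : ℚ) :=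
    modByMonic_cubicPolyRat_eq' z y x 0 (by rw [hp, cubicPolyRat_eq]; simp)
  have r1 : (p * X) %ₘ cubicPolyRat = C (y : ℚ) * X ^ 2 + C (x : ℚ) * X + C (2 * (z : ℚ)) :=
    modByMonic_cubicPolyRat_eq' y x (2 * z) (C (z : ℚ)) (by rw [hp, cubicPolyRat_eq]; simp; ring)
  have r2 : (p * X ^ 2) %ₘ cubicPolyRat = C (x : ℚ) * X ^ 2 + C (2 * (z : ℚ)) * X + C (2 * (y : ℚ)) :=
    modByMonic_cubicPolyRat_eq' x (2 * z) (2 * y) (C (z : ℚ) * X + C (y : ℚ))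
      (by rw [hp, cubicPolyRat_eq]; simp; ring)
  -- the matrix of multiplication by `p` on the basis reindexed by `Fin 3`
  set e := finCongr pbX_dim with he
  have hv : ∀ j : Fin 3, ((e.symm j : Fin pbX.dim) : ℕ) = (j : ℕ) := fun j => rfl
  have hent : ∀ i j : Fin 3,
      Algebra.leftMulMatrix (pbX.basis.reindex e) (AdjoinRoot.mk cubicPolyRat p) i j =
        ((p * X ^ (j : ℕ)) %ₘ cubicPolyRat).coeff (i : ℕ) := by
    intro i j
    rw [Algebra.leftMulMatrix_eq_repr_mul, Module.Basis.reindex_apply,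
      Module.Basis.repr_reindex_apply, ← Algebra.leftMulMatrix_eq_repr_mul, leftMulMatrix_mk,
      hv, hv]
  have hdet := Algebra.norm_eq_matrix_det (pbX.basis.reindex e) (AdjoinRoot.mk cubicPolyRat p)
  rw [Matrix.det_fin_three] at hdet
  simp only [hent, Fin.val_zero, Fin.val_one, Fin.val_two, pow_zero, mul_one, pow_one, r0, r1,
    r2, coeff_add, coeff_C_mul, coeff_X_pow, coeff_X, coeff_C] at hdet
  norm_num at hdet
  -- transfer to `𝓞_K`
  have h := Algebra.coe_norm_int (coordElt (x, y, z))
  have hK : ((coordElt (x, y, z) : 𝓞 K) : K) = AdjoinRoot.mk cubicPolyRat p := by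
    rw [hp, coordElt, map_add, map_add, map_mul, map_mul, map_pow, AdjoinRoot.mk_C, AdjoinRoot.mk_C,
      AdjoinRoot.mk_C, AdjoinRoot.mk_X]
    simp only [map_add, map_mul, map_pow, map_intCast, coe_θint,
      show AdjoinRoot.root cubicPolyRat = θ from rfl]
    ring
  rw [hK] at h
  suffices hq : ((Algebra.norm ℤ (coordElt (x, y, z)) : ℤ) : ℚ) =
      (x : ℚ) ^ 3 + 2 * (y : ℚ) ^ 3 + 4 * (z : ℚ) ^ 3 - 6 * x * y * z by exact_mod_cast hq
  rw [h, hdet]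
  ring

/-- `N((β)) = |x³ + 2y³ + 4z³ − 6xyz|` for `β = x + y·2^{1/3} + z·4^{1/3}`. [folklore] -/
theorem absNorm_span_coordElt (v : ℤ × ℤ × ℤ) :
    Ideal.absNorm (Ideal.span {coordElt v}) =
      (v.1 ^ 3 + 2 * v.2.1 ^ 3 + 4 * v.2.2 ^ 3 - 6 * v.1 * v.2.1 * v.2.2).natAbs := by
  rw [Ideal.absNorm_span_singleton, norm_coordElt]

/-- The same over `ℝ`: `N((β)) = |N(β̂)|` with `N` the norm form `normForm`. [folklore] -/
theorem absNorm_span_coordElt_real (v : ℤ × ℤ × ℤ) :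
    (Ideal.absNorm (Ideal.span {coordElt v}) : ℝ) = |normForm ((v.1 : ℝ), (v.2.1 : ℝ), (v.2.2 : ℝ))| := by
  rw [absNorm_span_coordElt, normForm]
  simp only
  rw [Nat.cast_natAbs, Int.cast_abs]
  push_cast
  ring_nf

/-! ### (8.1): the sum of `e_(β)` over a residue class, rearranged by the Möbius variable `J` -/

section EightOne

variable {X τ : ℝ}

open scoped Classical in
/-- The ideals `J` with `N(J) < L` (the range of the Möbius sum in `e_S`, (3.12)); contains `⊥`,
which is harmless as `μ(⊥) = 0`. [cite: HeathBrownActa2001, §3 (3.12)] -/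
def smallIdeals (L : ℝ) : Finset (Ideal (𝓞 K)) :=
  (idealsLE ⌊L⌋₊).filter (fun J => (Ideal.absNorm J : ℝ) < L)

/-- Membership in `smallIdeals L`: exactly `N(J) < L`. [folklore] -/
theorem mem_smallIdeals_iff {L : ℝ} {J : Ideal (𝓞 K)} : J ∈ smallIdeals L ↔ (Ideal.absNorm J : ℝ) < L := by
  classical
  simp only [smallIdeals, mem_filter, mem_idealsLE, and_iff_right_iff_imp]
  intro h
  exact Nat.le_floor h.le

open scoped Classical in
/-- For `S ≠ 0`, the divisors `J ∣ S` with `N(J) < L` are the members of `smallIdeals L` dividing `S`.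
[folklore] -/
theorem filter_idealDivisors_eq {S : Ideal (𝓞 K)} (hS : S ≠ ⊥) (L : ℝ) :
    (idealDivisors S).filter (fun J => (Ideal.absNorm J : ℝ) < L) =
      (smallIdeals L).filter (fun J => J ∣ S) := by
  ext J
  simp only [mem_filter, mem_idealDivisors_iff hS, mem_smallIdeals_iff]
  tauto

/-- `w'(0) = 0` (`X > 0`): the weight vanishes below `X^{ξ∑m_i} > 0`. [cite: HeathBrownActa2001, §3 (3.12)] -/
theorem wDeriv_zero (hX : 0 < X) {k : ℕ} (m : Fin k → ℕ) : wDeriv X τ m 0 = 0 :=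
  wDeriv_eq_zero hX m (Or.inl (Real.rpow_pos_of_pos hX _))

open scoped Classical in
/-- **(8.1)** (p. 47): "According to the definition (3.12) we have
`∑_{β ≡ α (mod q), β̂ ∈ 𝒞} e_(β) = M⁻¹(ξ log X)^{−n−1} ∑_{N(J) < L} μ(J) log(L/N(J)) ∑_{β̂ ∈ 𝒞, J ∣ β, β ≡ α (mod q)} w'(N(β))`"
— here with `M⁻¹(ξ log X)^{−n−1}` in the form `(∏ m_i ξ log X)⁻¹` of (3.12), for every `X > 0` (the
term `β = 0`, if present, vanishes on both sides since `w'(0) = 0`). [cite: HeathBrownActa2001, §8 (8.1)] -/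
theorem cubeClassSum_eWeight_eq (hX : 0 < X) {k : ℕ} (m : Fin k → ℕ) (q : ℕ) (α : 𝓞 K)
    (a : ℝ × ℝ × ℝ) (S₀ : ℝ) :
    cubeClassSum (eWeight X τ m) q α a S₀ =
      (∏ i, ((m i : ℝ) * hbXi τ * Real.log X))⁻¹ *
        ∑ J ∈ smallIdeals (hbL X τ), idealMoebius J * Real.log (hbL X τ / Ideal.absNorm J) *
          ∑ v ∈ ((latticeCube a S₀).filter (fun v => (q : 𝓞 K) ∣ coordElt v - α)).filter
              (fun v => J ∣ Ideal.span {coordElt v}),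
            wDeriv X τ m (Ideal.absNorm (Ideal.span {coordElt v})) := by
  set F := (latticeCube a S₀).filter (fun v => (q : 𝓞 K) ∣ coordElt v - α) with hF
  set P := ∏ i, ((m i : ℝ) * hbXi τ * Real.log X) with hP
  set L := hbL X τ with hL
  -- each term, reorganised over `smallIdeals`
  have hterm : ∀ v : ℤ × ℤ × ℤ, eWeight X τ m (Ideal.span {coordElt v}) =
      P⁻¹ * ∑ J ∈ (smallIdeals L).filter (fun J => J ∣ Ideal.span {coordElt v}),
        idealMoebius J * Real.log (L / Ideal.absNorm J) *
          wDeriv X τ m (Ideal.absNorm (Ideal.span {coordElt v})) := by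
    intro v
    by_cases hv : Ideal.span {coordElt v} = ⊥
    · rw [eWeight, hv, Ideal.absNorm_bot, Nat.cast_zero, wDeriv_zero hX]
      simp
    · rw [eWeight, ← filter_idealDivisors_eq hv, div_eq_mul_inv, mul_comm (wDeriv X τ m _), mul_assoc,
        Finset.mul_sum]
      congr 1
      refine Finset.sum_congr rfl fun J _ => ?_
      ring
  calc cubeClassSum (eWeight X τ m) q α a S₀ = ∑ v ∈ F, eWeight X τ m (Ideal.span {coordElt v}) := rfl
    _ = ∑ v ∈ F, P⁻¹ * ∑ J ∈ (smallIdeals L).filter (fun J => J ∣ Ideal.span {coordElt v}),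
          idealMoebius J * Real.log (L / Ideal.absNorm J) *
            wDeriv X τ m (Ideal.absNorm (Ideal.span {coordElt v})) := Finset.sum_congr rfl fun v _ => hterm v
    _ = P⁻¹ * ∑ v ∈ F, ∑ J ∈ smallIdeals L, if J ∣ Ideal.span {coordElt v} then
          idealMoebius J * Real.log (L / Ideal.absNorm J) *
            wDeriv X τ m (Ideal.absNorm (Ideal.span {coordElt v})) else 0 := by
        rw [Finset.mul_sum]
        refine Finset.sum_congr rfl fun v _ => ?_
        rw [Finset.sum_filter]
    _ = P⁻¹ * ∑ J ∈ smallIdeals L, ∑ v ∈ F, if J ∣ Ideal.span {coordElt v} then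
          idealMoebius J * Real.log (L / Ideal.absNorm J) *
            wDeriv X τ m (Ideal.absNorm (Ideal.span {coordElt v})) else 0 := by
        rw [Finset.sum_comm]
    _ = P⁻¹ * ∑ J ∈ smallIdeals L, idealMoebius J * Real.log (L / Ideal.absNorm J) *
          ∑ v ∈ F.filter (fun v => J ∣ Ideal.span {coordElt v}),
            wDeriv X τ m (Ideal.absNorm (Ideal.span {coordElt v})) := by
        congr 1
        refine Finset.sum_congr rfl fun J _ => ?_
        conv_rhs => rw [Finset.sum_filter, Finset.mul_sum]
        refine Finset.sum_congr rfl fun v _ => ?_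
        split_ifs <;> simp

end EightOne

/-! ### The conditions `J ∣ β`, `β ≡ α (mod q)`: compatibility and the class modulo `[J, q]` -/

section Compat

/-- "The two conditions `J ∣ β` and `β ≡ α (mod q)` are compatible only when `(J, q) ∣ α`" (p. 47):
a `β₀ ∈ J` with `β₀ ≡ α (mod q)` exists iff `α ∈ J + (q)`. [cite: HeathBrownActa2001, §8 p. 47] -/
theorem exists_mem_and_dvd_sub_iff (J : Ideal (𝓞 K)) (q : ℕ) (α : 𝓞 K) :
    (∃ β₀ : 𝓞 K, β₀ ∈ J ∧ (q : 𝓞 K) ∣ β₀ - α) ↔ α ∈ J ⊔ Ideal.span {(q : 𝓞 K)} := by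
  constructor
  · rintro ⟨β₀, hJ, hq⟩
    have : α = β₀ - (β₀ - α) := by ring
    rw [this]
    exact Ideal.sub_mem _ (Ideal.mem_sup_left hJ) (Ideal.mem_sup_right (Ideal.mem_span_singleton.mpr hq))
  · intro h
    obtain ⟨y, hy, z, hz, hyz⟩ := Submodule.mem_sup.mp h
    refine ⟨y, hy, ?_⟩
    have : y - α = -z := by rw [← hyz]; ring
    rw [this]
    exact (Ideal.mem_span_singleton.mp hz).neg_right

/-- "… and in this latter case they define a unique residue class for `β` modulo the lowest common
multiple `[J, q]`" (p. 47): given one solution `β₀`, the conditions `J ∣ β`, `β ≡ α (mod q)` say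
`β − β₀ ∈ J ∩ (q)`. [cite: HeathBrownActa2001, §8 p. 47] -/
theorem dvd_span_and_dvd_sub_iff {J : Ideal (𝓞 K)} {q : ℕ} {α β₀ : 𝓞 K} (h₀J : β₀ ∈ J)
    (h₀q : (q : 𝓞 K) ∣ β₀ - α) (β : 𝓞 K) :
    (J ∣ Ideal.span {β} ∧ (q : 𝓞 K) ∣ β - α) ↔ β - β₀ ∈ J ⊓ Ideal.span {(q : 𝓞 K)} := by
  rw [Ideal.dvd_span_singleton, Ideal.mem_inf, Ideal.mem_span_singleton]
  constructor
  · rintro ⟨hJ, hq⟩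
    refine ⟨Ideal.sub_mem _ hJ h₀J, ?_⟩
    have : β - β₀ = (β - α) - (β₀ - α) := by ring
    rw [this]; exact dvd_sub hq h₀q
  · rintro ⟨hJ, hq⟩
    refine ⟨?_, ?_⟩
    · have := Ideal.add_mem _ hJ h₀J
      rwa [sub_add_cancel] at this
    · have : β - α = (β - β₀) + (β₀ - α) := by ring
      rw [this]; exact dvd_add hq h₀q

/-- The lowest common multiple `J ∩ (q)` has norm at most `N(J)q³` (it contains `J·(q)`), for `J ≠ 0`,
`q ≥ 1`. [folklore] -/
theorem absNorm_inf_span_le {J : Ideal (𝓞 K)} (hJ : J ≠ ⊥) {q : ℕ} (hq : 0 < q) :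
    Ideal.absNorm (J ⊓ Ideal.span {(q : 𝓞 K)}) ≤ Ideal.absNorm J * q ^ 3 := by
  have hle : J * Ideal.span {(q : 𝓞 K)} ≤ J ⊓ Ideal.span {(q : 𝓞 K)} := Ideal.mul_le_inf
  have hdvd := Ideal.absNorm_dvd_absNorm_of_le hle
  rw [map_mul, absNorm_span_natCast_K] at hdvd
  refine Nat.le_of_dvd ?_ hdvd
  have hJ0 : 0 < Ideal.absNorm J := Nat.pos_of_ne_zero fun h => hJ (Ideal.absNorm_eq_zero_iff.mp h)
  positivity

/-- `J ∩ (q) ≠ 0` for `J ≠ 0`, `q ≥ 1`. [folklore] -/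
theorem inf_span_ne_bot {J : Ideal (𝓞 K)} (hJ : J ≠ ⊥) {q : ℕ} (hq : 0 < q) :
    J ⊓ Ideal.span {(q : 𝓞 K)} ≠ ⊥ := by
  intro h
  have hle : J * Ideal.span {(q : 𝓞 K)} ≤ J ⊓ Ideal.span {(q : 𝓞 K)} := Ideal.mul_le_inf
  rw [h, le_bot_iff, Ideal.mul_eq_bot] at hle
  rcases hle with h1 | h2
  · exact hJ h1
  · rw [Ideal.span_singleton_eq_bot] at h2
    exact (Nat.cast_ne_zero.mpr hq.ne') h2

end Compat

end Literature.NumberTheory.Sieve.CubicSieve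

end
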